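import Summits.QuantumFields.YangMills.Theses.PencilRigidity

/-!
# QuantumFields / YangMills / PencilRigidity — the assembly `Assembly` (revision 5)

Route `route-QuantumFields-PencilRigidity`, item stmt-QuantumFields-16121 (`Assembly`, rank 1),
re-typed 2026-08-16 after the statement revision p116790 (`HypercubicLimit` ↦
`WeakCouplingHypercubicLimit`; the species bookkeeping `SpeciesProjectionPlanar` is no longer a
hypothesis):

  `ShellRigidity → NPointIsotropy → CurvatureKernelBound → DiagonalMirrorRPR →
   WeakCouplingHypercubicLimit → CurvatureChannel → KernelTransfer → PlanarToEuclidean → YangMills`.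

This is, verbatim, the curried type of the route's current deciding theorem
`Summit.QuantumFields.YangMills.Theses.PencilRigidity.closes` (the weak-coupling existence leg in
one-field gauge supplies `(r, sch, S)`; `CurvatureChannel` restricts to the curvature channel and
transports E2 to the four axis frames, `DiagonalMirrorRPR` adds the four diagonal frames;
`CurvatureKernelBound` gives the real two-point kernel, `KernelTransfer` moves the symmetries and
the eight frames onto it, `ShellRigidity` makes it `O(4)`-invariant off the origin, `NPointIsotropy`
upgrades to planar rotations of every curvature string, the other species strings vanish in
one-field gauge, and `PlanarToEuclidean` generates `SO(4)`; the Osterwalder–Schrader package of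
`YangMills` is then read off). So the assembly closes by that theorem: pure logic, no new
mathematics. The pre-revision assembly (item stmt-QuantumFields-11691) is
`Theorems/PencilRigidityAssembly.lean`; this file only re-targets the revised decl.

References: K. Osterwalder, R. Schrader, Comm. Math. Phys. 42 (1975) 281–305;
A. Jaffe, E. Witten, *Quantum Yang–Mills theory* (Clay problem description, 2000).
-/

namespace Summit.QuantumFields.YangMills.Theorems

/-- **Assembly of route PencilRigidity, revision 5** (item stmt-QuantumFields-16121): the eight
route items `ShellRigidity`, `NPointIsotropy`, `CurvatureKernelBound`, `DiagonalMirrorRPR`,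
`WeakCouplingHypercubicLimit`, `CurvatureChannel`, `KernelTransfer`, `PlanarToEuclidean` imply
`YangMills`. The statement is literally the curried type of the route's deciding theorem `closes`,
which proves it after unfolding. [OsterwalderSchrader1975; JaffeWitten2000] -/
theorem pencilRigidityAssembly_weakCoupling_proof :
    Summit.QuantumFields.YangMills.Theses.PencilRigidity.Assembly := by
  unfold Summit.QuantumFields.YangMills.Theses.PencilRigidity.Assembly
  exact Summit.QuantumFields.YangMills.Theses.PencilRigidity.closes

end Summit.QuantumFields.YangMills.Theorems
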